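import Mathlib

/-
  SeedCheckerFullExchangeCore.lean (hsemireg-c5c8-1 g37).  Mathlib-only, sorry-free, hand-written.
  The CLASS-LEVEL two-block model of the C5–C8 seed checker with FULL row exchange (all eight global moment rows shared between the
  two blocks; g36's `SeedCheckerPairLaw` assumed rows 0–5 vanish per block).  Contents: model predicates (§1–2), exact LP certificates
  and their soundness = weak duality + integrality windows (§3), a kernel-cheap forward-difference evaluator proved correct (§3b),
  the row-5 branch law (§3c), verdicts and their soundness (§4).  The GENERATED files `SeedCheckerFullExchangeG1..G4.lean` (one kernel-checked verdict per
  cell, T ≤ 1309) and `SeedCheckerFullExchangeLaw.lean` (the assembled laws) import this file.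
  Token: line stmt-HodgeConjecture-18881 Cruxes/BlochSeedDiscOne/Lines/birth.lean 814a6a70c14e831a stub_rung_pad4_seedAt
  (the stub is neither restated nor weakened; this file does not import the route).
  HONEST FRAMING.  Nothing here is proved toward HC / HC_CM / HC_AV / ladder rung №4 / stmt-26512 / stmt-18881 / H2.  This seat produces
  EVIDENCE and TYPED FILES about the reduced CLASS-LEVEL model (a CONTROL search space), not rungs.
-/

set_option linter.dupNamespace false
set_option linter.style.longFile 0
set_option maxRecDepth 100000

namespace Summit.HodgeConjecture.HodgeConjecture.Cruxes.BlochSeedDiscOne.SeedChecker.FullExchange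

open Finset

/-! ## §1 The class-level two-block model with FULL row exchange -/

/-- Binomial coefficient `C(j,i)` as an integer, computed as `j(j−1)⋯(j−i+1) / i!` (kernel-friendly; `binomZ_eq`). -/
def binomZ (j i : ℕ) : ℤ := ((Nat.descFactorial j i / Nat.factorial i : ℕ) : ℤ)

theorem binomZ_eq (j i : ℕ) : binomZ j i = ((Nat.choose j i : ℕ) : ℤ) := by
  rw [binomZ, Nat.choose_eq_descFactorial_div_factorial]

@[simp] theorem binomZ_zero (j : ℕ) : binomZ j 0 = 1 := by simp [binomZ_eq]

@[simp] theorem binomZ_one (j : ℕ) : binomZ j 1 = j := by simp [binomZ_eq]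

/-- local binomial row `i` of a block `G` on scales `0..n`: `Σ_{j ≤ n} G j · C(j,i)`. -/
def brow (G : ℕ → ℤ) (n i : ℕ) : ℤ := ∑ j ∈ range (n + 1), G j * binomZ j i

/-- caps of a TOP block of degree `nt` sitting `g` empty scales above the last chain pair (g36 verbatim). -/
def topU (nt g j : ℕ) : ℤ := if j = nt then -5 else if j + g ≤ 3 then 0 else 4

/-- caps of a BOTTOM block of degree `nb` (P-first, junction scale `nb`; g36 verbatim). -/
def botU (nb j : ℕ) : ℤ := if j = 0 then -1 else if j = nb then 0 else 4

/-- the absolute scale `t0 = nb + 1257 + g` of the bottom of the top block. -/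
def tz (nb g : ℕ) : ℕ := nb + 1257 + g

/-- g36's `tzero` (as an integer). -/
def tzero (nb g : ℕ) : ℤ := ((nb + 1257 + g : ℕ) : ℤ)

/-- GLOBAL binomial row `i` of a top block whose local scale `j` is the absolute scale `t0 + j`, written in local rows:
`Σ_{l ≤ i} C(t0, i − l) · ρ_l`  (`= Σ_j G j · C(t0 + j, i)` by Vandermonde, `trow_eq_global`; the bottom block sits at absolute
scales `0..nb`, so its global rows ARE its local rows). -/
def trow (G : ℕ → ℤ) (nt t0 i : ℕ) : ℤ := ∑ l ∈ range (i + 1), binomZ t0 (i - l) * brow G nt l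

/-- right-hand side of the global moment system forced by (A1)+LF at class level: `Σ_k G_k C(k,i) = −[i = 7]`, `i = 0..7`. -/
def rhs (i : ℕ) : ℤ := if i = 7 then -1 else 0

/-- a pair of blocks in the cell `(nb, nt, g)` of the FULL-EXCHANGE family: caps, and the eight GLOBAL binomial rows of the whole
tower — nothing else (no row is assumed to vanish blockwise; the blocks may exchange every row). -/
def IsPairFull (nb nt g : ℕ) (Gb Gt : ℕ → ℤ) : Prop :=
  (∀ j < nb + 1, Gb j ≤ botU nb j) ∧ (∀ j < nt + 1, Gt j ≤ topU nt g j) ∧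
    ∀ i < 8, brow Gb nb i + trow Gt nt (tz nb g) i = rhs i

/-- the cell carries no pair of the full-exchange family. -/
def CellDeadFull (nb nt g : ℕ) : Prop := ∀ Gb Gt : ℕ → ℤ, ¬ IsPairFull nb nt g Gb Gt

/-- g36's predicates, verbatim: blocks with vanishing rows 0..5 exchanging rows 6, 7 only (the «row-6 charge» family). -/
def IsTop (nt g : ℕ) (G : ℕ → ℤ) : Prop := (∀ j < nt + 1, G j ≤ topU nt g j) ∧ ∀ i < 6, brow G nt i = 0

def IsBot (nb : ℕ) (G : ℕ → ℤ) : Prop := (∀ j < nb + 1, G j ≤ botU nb j) ∧ ∀ i < 6, brow G nb i = 0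

def IsPair (nb nt g : ℕ) (Gb Gt : ℕ → ℤ) : Prop :=
  IsBot nb Gb ∧ IsTop nt g Gt ∧ brow Gt nt 6 + brow Gb nb 6 = 0 ∧
    brow Gt nt 7 + brow Gb nb 7 + tzero nb g * brow Gt nt 6 = -1

def CellDead (nb nt g : ℕ) : Prop := ∀ Gb Gt : ℕ → ℤ, ¬ IsPair nb nt g Gb Gt

/-- «the full-exchange family REDUCES to the row-6 family in this cell». -/
def Reduces (nb nt g : ℕ) : Prop := ∀ Gb Gt : ℕ → ℤ, IsPairFull nb nt g Gb Gt → IsPair nb nt g Gb Gt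

/-! ## §2 Algebra of the two families -/

/-- the eight global rows, expanded. -/
theorem rows_expand {nb nt g : ℕ} {Gb Gt : ℕ → ℤ} (h : IsPairFull nb nt g Gb Gt) :
    brow Gb nb 0 + brow Gt nt 0 = 0 ∧
    brow Gb nb 1 + (binomZ (tz nb g) 1 * brow Gt nt 0 + brow Gt nt 1) = 0 ∧
    brow Gb nb 2 + (binomZ (tz nb g) 2 * brow Gt nt 0 + binomZ (tz nb g) 1 * brow Gt nt 1 + brow Gt nt 2) = 0 ∧
    brow Gb nb 3 + (binomZ (tz nb g) 3 * brow Gt nt 0 + binomZ (tz nb g) 2 * brow Gt nt 1 + binomZ (tz nb g) 1 * brow Gt nt 2 +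
      brow Gt nt 3) = 0 ∧
    brow Gb nb 4 + (binomZ (tz nb g) 4 * brow Gt nt 0 + binomZ (tz nb g) 3 * brow Gt nt 1 + binomZ (tz nb g) 2 * brow Gt nt 2 +
      binomZ (tz nb g) 1 * brow Gt nt 3 + brow Gt nt 4) = 0 ∧
    brow Gb nb 5 + (binomZ (tz nb g) 5 * brow Gt nt 0 + binomZ (tz nb g) 4 * brow Gt nt 1 + binomZ (tz nb g) 3 * brow Gt nt 2 +
      binomZ (tz nb g) 2 * brow Gt nt 3 + binomZ (tz nb g) 1 * brow Gt nt 4 + brow Gt nt 5) = 0 ∧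
    brow Gb nb 6 + (binomZ (tz nb g) 6 * brow Gt nt 0 + binomZ (tz nb g) 5 * brow Gt nt 1 + binomZ (tz nb g) 4 * brow Gt nt 2 +
      binomZ (tz nb g) 3 * brow Gt nt 3 + binomZ (tz nb g) 2 * brow Gt nt 4 + binomZ (tz nb g) 1 * brow Gt nt 5 + brow Gt nt 6) = 0 ∧
    brow Gb nb 7 + (binomZ (tz nb g) 7 * brow Gt nt 0 + binomZ (tz nb g) 6 * brow Gt nt 1 + binomZ (tz nb g) 5 * brow Gt nt 2 +
      binomZ (tz nb g) 4 * brow Gt nt 3 + binomZ (tz nb g) 3 * brow Gt nt 4 + binomZ (tz nb g) 2 * brow Gt nt 5 +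
      binomZ (tz nb g) 1 * brow Gt nt 6 + brow Gt nt 7) = -1 := by
  obtain ⟨-, -, hr⟩ := h
  have e : ∀ i < 8, brow Gb nb i + trow Gt nt (tz nb g) i = rhs i := hr
  refine ⟨?_, ?_, ?_, ?_, ?_, ?_, ?_, ?_⟩
  · simpa [trow, rhs, sum_range_succ] using e 0 (by norm_num)
  · simpa [trow, rhs, sum_range_succ] using e 1 (by norm_num)
  · simpa [trow, rhs, sum_range_succ] using e 2 (by norm_num)
  · simpa [trow, rhs, sum_range_succ] using e 3 (by norm_num)
  · simpa [trow, rhs, sum_range_succ] using e 4 (by norm_num)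
  · simpa [trow, rhs, sum_range_succ] using e 5 (by norm_num)
  · simpa [trow, rhs, sum_range_succ] using e 6 (by norm_num)
  · simpa [trow, rhs, sum_range_succ] using e 7 (by norm_num)

/-- the row-6 family is a sub-family of the full-exchange family (pure algebra, every cell). -/
theorem isPairFull_of_isPair {nb nt g : ℕ} {Gb Gt : ℕ → ℤ} (h : IsPair nb nt g Gb Gt) : IsPairFull nb nt g Gb Gt := by
  obtain ⟨⟨hUb, hb⟩, ⟨hUt, ht⟩, h6, h7⟩ := h
  refine ⟨hUb, hUt, ?_⟩
  intro i hi
  interval_cases i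
  · simp [trow, rhs, hb 0 (by norm_num), ht 0 (by norm_num)]
  · simp [trow, rhs, sum_range_succ, hb 1 (by norm_num), ht 0 (by norm_num), ht 1 (by norm_num)]
  · simp [trow, rhs, sum_range_succ, hb 2 (by norm_num), ht 0 (by norm_num), ht 1 (by norm_num), ht 2 (by norm_num)]
  · simp [trow, rhs, sum_range_succ, hb 3 (by norm_num), ht 0 (by norm_num), ht 1 (by norm_num), ht 2 (by norm_num),
      ht 3 (by norm_num)]
  · simp [trow, rhs, sum_range_succ, hb 4 (by norm_num), ht 0 (by norm_num), ht 1 (by norm_num), ht 2 (by norm_num),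
      ht 3 (by norm_num), ht 4 (by norm_num)]
  · simp [trow, rhs, sum_range_succ, hb 5 (by norm_num), ht 0 (by norm_num), ht 1 (by norm_num), ht 2 (by norm_num),
      ht 3 (by norm_num), ht 4 (by norm_num), ht 5 (by norm_num)]
  · simp [trow, rhs, sum_range_succ, ht 0 (by norm_num), ht 1 (by norm_num), ht 2 (by norm_num),
      ht 3 (by norm_num), ht 4 (by norm_num), ht 5 (by norm_num)]
    linarith
  · simp [trow, rhs, sum_range_succ, ht 0 (by norm_num), ht 1 (by norm_num), ht 2 (by norm_num),
      ht 3 (by norm_num), ht 4 (by norm_num), ht 5 (by norm_num), tzero, tz] at h7 ⊢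
    linarith

/-- both blocks' LOCAL rows below `m` vanish. -/
def LowZero (nb nt m : ℕ) (Gb Gt : ℕ → ℤ) : Prop := ∀ l < m, brow Gb nb l = 0 ∧ brow Gt nt l = 0

theorem lowZero_zero {nb nt : ℕ} {Gb Gt : ℕ → ℤ} : LowZero nb nt 0 Gb Gt := fun l hl => absurd hl (Nat.not_lt_zero l)

/-- one more vanishing BOTTOM row propagates to the top block through the global row `m` (`m ≤ 6`). -/
theorem lowZero_succ {nb nt g m : ℕ} {Gb Gt : ℕ → ℤ} (h : IsPairFull nb nt g Gb Gt) (hz : LowZero nb nt m Gb Gt)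
    (hm : m ≤ 6) (hb : brow Gb nb m = 0) : LowZero nb nt (m + 1) Gb Gt := by
  have hrow := h.2.2 m (by omega)
  rw [rhs, if_neg (by omega), hb, zero_add, trow, sum_range_succ, Nat.sub_self, binomZ_zero, one_mul] at hrow
  have hrest : ∑ x ∈ range m, binomZ (tz nb g) (m - x) * brow Gt nt x = 0 :=
    sum_eq_zero fun x hx => by rw [(hz x (mem_range.1 hx)).2, mul_zero]
  rw [hrest, zero_add] at hrow
  intro l hl
  rcases Nat.lt_succ_iff_lt_or_eq.1 hl with hl' | rfl
  · exact hz l hl'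
  · exact ⟨hb, hrow⟩

/-- with all six low rows vanishing, a full-exchange pair IS a row-6 pair. -/
theorem isPair_of_lowZero6 {nb nt g : ℕ} {Gb Gt : ℕ → ℤ} (h : IsPairFull nb nt g Gb Gt) (hz : LowZero nb nt 6 Gb Gt) :
    IsPair nb nt g Gb Gt := by
  obtain ⟨-, -, -, -, -, -, r6, r7⟩ := rows_expand h
  obtain ⟨hUb, hUt, -⟩ := h
  have b0 := (hz 0 (by norm_num)); have b1 := (hz 1 (by norm_num)); have b2 := (hz 2 (by norm_num))
  have b3 := (hz 3 (by norm_num)); have b4 := (hz 4 (by norm_num)); have b5 := (hz 5 (by norm_num))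
  refine ⟨⟨hUb, fun i hi => ?_⟩, ⟨hUt, fun i hi => ?_⟩, ?_, ?_⟩
  · interval_cases i <;> simp [b0, b1, b2, b3, b4, b5]
  · interval_cases i <;> simp [b0, b1, b2, b3, b4, b5]
  · rw [b0.2, b1.2, b2.2, b3.2, b4.2, b5.2] at r6; linarith
  · simp only [b0.2, b1.2, b2.2, b3.2, b4.2, b5.2, binomZ_one, mul_zero, add_zero, zero_add, tz, Nat.cast_add,
      Nat.cast_ofNat] at r7
    simp only [tzero, Nat.cast_add, Nat.cast_ofNat]
    linarith

/-! ## §3 Certificates (LP duality) and their soundness -/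

/-- an 8-coefficient polynomial functional `Σ_{i<8} aᵢ C(j,i)`. -/
def poly8 (a0 a1 a2 a3 a4 a5 a6 a7 : ℤ) (j : ℕ) : ℤ :=
  a0 * binomZ j 0 + a1 * binomZ j 1 + a2 * binomZ j 2 + a3 * binomZ j 3 + a4 * binomZ j 4 + a5 * binomZ j 5 +
    a6 * binomZ j 6 + a7 * binomZ j 7

theorem pairing8 (G : ℕ → ℤ) (n : ℕ) (a0 a1 a2 a3 a4 a5 a6 a7 : ℤ) :
    ∑ j ∈ range (n + 1), G j * poly8 a0 a1 a2 a3 a4 a5 a6 a7 j =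
      a0 * brow G n 0 + a1 * brow G n 1 + a2 * brow G n 2 + a3 * brow G n 3 + a4 * brow G n 4 + a5 * brow G n 5 +
        a6 * brow G n 6 + a7 * brow G n 7 := by
  simp only [brow, poly8, mul_sum, ← sum_add_distrib]
  exact sum_congr rfl fun j _ => by ring

/-- weighted caps: `G ≤ U` pointwise and `w ≥ 0` pointwise give `Σ G w ≤ Σ U w`. -/
theorem capped_sum (n : ℕ) (G U w : ℕ → ℤ) (hG : ∀ j < n + 1, G j ≤ U j) (hw : ∀ j < n + 1, 0 ≤ w j) :
    ∑ j ∈ range (n + 1), G j * w j ≤ ∑ j ∈ range (n + 1), U j * w j :=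
  sum_le_sum fun j hj => mul_le_mul_of_nonneg_right (hG j (mem_range.mp hj)) (hw j (mem_range.mp hj))

/-- A stage-`m` certificate for the cell `(nb, nt, g)`: multipliers `Y0..Y7` of the eight global rows (for `i < m`, `Yᵢ` is the free
multiplier of the vanishing bottom row `βᵢ = 0`), free multipliers `Z0..Z5` of the vanishing local top rows `ρ_l = 0`, `l < m`, and the
coefficient `S` of the bounded row `β_m` (`S > 0`: upper bound, `S < 0`: lower bound, `S = 0`: Farkas / infeasibility). -/
structure Cert where
  nb : ℕ
  nt : ℕ
  g : ℕ
  m : ℕ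
  S : ℤ
  Y0 : ℤ
  Y1 : ℤ
  Y2 : ℤ
  Y3 : ℤ
  Y4 : ℤ
  Y5 : ℤ
  Y6 : ℤ
  Y7 : ℤ
  Z0 : ℤ
  Z1 : ℤ
  Z2 : ℤ
  Z3 : ℤ
  Z4 : ℤ
  Z5 : ℤ

namespace Cert

variable (c : Cert)

/-- `C(t0, k)`. -/
def tb (k : ℕ) : ℤ := binomZ (tz c.nb c.g) k

/-- the DERIVED local top coefficients `zd_l = Σ_{i ≥ l} Yᵢ C(t0, i − l)` (the global rows re-expanded at the top block). -/
def zd0 : ℤ := c.Y0 * c.tb 0 + c.Y1 * c.tb 1 + c.Y2 * c.tb 2 + c.Y3 * c.tb 3 + c.Y4 * c.tb 4 + c.Y5 * c.tb 5 + c.Y6 * c.tb 6 +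
  c.Y7 * c.tb 7
def zd1 : ℤ := c.Y1 * c.tb 0 + c.Y2 * c.tb 1 + c.Y3 * c.tb 2 + c.Y4 * c.tb 3 + c.Y5 * c.tb 4 + c.Y6 * c.tb 5 + c.Y7 * c.tb 6
def zd2 : ℤ := c.Y2 * c.tb 0 + c.Y3 * c.tb 1 + c.Y4 * c.tb 2 + c.Y5 * c.tb 3 + c.Y6 * c.tb 4 + c.Y7 * c.tb 5
def zd3 : ℤ := c.Y3 * c.tb 0 + c.Y4 * c.tb 1 + c.Y5 * c.tb 2 + c.Y6 * c.tb 3 + c.Y7 * c.tb 4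
def zd4 : ℤ := c.Y4 * c.tb 0 + c.Y5 * c.tb 1 + c.Y6 * c.tb 2 + c.Y7 * c.tb 3
def zd5 : ℤ := c.Y5 * c.tb 0 + c.Y6 * c.tb 1 + c.Y7 * c.tb 2
def zd6 : ℤ := c.Y6 * c.tb 0 + c.Y7 * c.tb 1
def zd7 : ℤ := c.Y7 * c.tb 0

/-- the actual top coefficients: free below the stage, derived from the stage on. -/
def z0 : ℤ := if 0 < c.m then c.Z0 else c.zd0
def z1 : ℤ := if 1 < c.m then c.Z1 else c.zd1
def z2 : ℤ := if 2 < c.m then c.Z2 else c.zd2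
def z3 : ℤ := if 3 < c.m then c.Z3 else c.zd3
def z4 : ℤ := if 4 < c.m then c.Z4 else c.zd4
def z5 : ℤ := if 5 < c.m then c.Z5 else c.zd5

/-- bottom functional `w_b(j) = Σ Yᵢ C(j,i) + S·C(j,m)`. -/
def wb (j : ℕ) : ℤ := poly8 c.Y0 c.Y1 c.Y2 c.Y3 c.Y4 c.Y5 c.Y6 c.Y7 j + c.S * binomZ j c.m

/-- top functional (local scales) `w_t(j) = Σ z_l C(j,l)`. -/
def wt (j : ℕ) : ℤ := poly8 c.z0 c.z1 c.z2 c.z3 c.z4 c.z5 c.zd6 c.zd7 j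

/-- cap-weighted mass of the certificate. -/
def B : ℤ := (∑ j ∈ range (c.nb + 1), botU c.nb j * c.wb j) + ∑ j ∈ range (c.nt + 1), topU c.nt c.g j * c.wt j

/-- the bound the certificate proves for `S·β_m`. -/
def R : ℤ := c.B + c.Y7

/-- nonnegativity of both functionals on their blocks (decidable). -/
abbrev OK : Prop := (∀ j < c.nb + 1, 0 ≤ c.wb j) ∧ (∀ j < c.nt + 1, 0 ≤ c.wt j)

end Cert

/-! ## §3b FAST EVALUATION by forward differences
The kernel never evaluates a binomial coefficient: a degree-7 polynomial given by its Newton coefficients `d0..d7` at the current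
point is advanced one point by `dᵢ ← dᵢ + dᵢ₊₁`; `D8.run` scans a block, checking nonnegativity and accumulating the cap-weighted
mass.  `Cert.chk` is proved to compute exactly `(Cert.OK, Cert.R)` (`Cert.chk_spec`). -/

/-- the difference engine: current values of `Δ⁰w, …, Δ⁷w`. -/
structure D8 where
  d0 : ℤ
  d1 : ℤ
  d2 : ℤ
  d3 : ℤ
  d4 : ℤ
  d5 : ℤ
  d6 : ℤ
  d7 : ℤ

namespace D8

/-- advance one point. -/
def step (e : D8) : D8 :=
  ⟨e.d0 + e.d1, e.d1 + e.d2, e.d2 + e.d3, e.d3 + e.d4, e.d4 + e.d5, e.d5 + e.d6, e.d6 + e.d7, e.d7⟩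

/-- the polynomial with Newton coefficients `e`, evaluated `j` points ahead. -/
def val (e : D8) (j : ℕ) : ℤ := poly8 e.d0 e.d1 e.d2 e.d3 e.d4 e.d5 e.d6 e.d7 j

theorem val_zero (e : D8) : e.val 0 = e.d0 := by
  simp [val, poly8, binomZ_eq]

theorem pascalZ (j i : ℕ) : binomZ (j + 1) (i + 1) = binomZ j i + binomZ j (i + 1) := by
  rw [binomZ_eq, binomZ_eq, binomZ_eq, Nat.choose_succ_succ]; push_cast; ring

theorem val_step (e : D8) (j : ℕ) : e.step.val j = e.val (j + 1) := by
  have p0 : binomZ (j + 1) 0 = binomZ j 0 := by rw [binomZ_eq, binomZ_eq, Nat.choose_zero_right, Nat.choose_zero_right]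
  have p1 := pascalZ j 0
  have p2 := pascalZ j 1
  have p3 := pascalZ j 2
  have p4 := pascalZ j 3
  have p5 := pascalZ j 4
  have p6 := pascalZ j 5
  have p7 := pascalZ j 6
  simp only [val, step, poly8]
  rw [p0, p1, p2, p3, p4, p5, p6, p7]
  ring

/-- scan the points `j, j+1, …, j+n-1` (the state `e` sits at point `j`): (all values `≥ 0`, `Σ cap(point)·value`). -/
def run (cap : ℕ → ℤ) : D8 → ℕ → ℕ → Bool × ℤ
  | _, _, 0 => (true, 0)
  | e, j, n + 1 =>
    let r := run cap e.step (j + 1) n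
    (decide (0 ≤ e.d0) && r.1, cap j * e.d0 + r.2)

theorem run_fst (cap : ℕ → ℤ) :
    ∀ (n : ℕ) (e : D8) (j : ℕ), (run cap e j n).1 = true → ∀ k < n, 0 ≤ e.val k
  | 0, _, _, _ => fun k hk => absurd hk (Nat.not_lt_zero k)
  | n + 1, e, j, h => by
    simp only [run, Bool.and_eq_true, decide_eq_true_eq] at h
    intro k hk
    rcases k with _ | k
    · rw [val_zero]; exact h.1
    · rw [← val_step]; exact run_fst cap n e.step (j + 1) h.2 k (by omega)

theorem run_snd (cap : ℕ → ℤ) :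
    ∀ (n : ℕ) (e : D8) (j : ℕ), (run cap e j n).2 = ∑ k ∈ range n, cap (j + k) * e.val k
  | 0, _, _ => by simp [run]
  | n + 1, e, j => by
    simp only [run]
    rw [run_snd cap n e.step (j + 1), sum_range_succ', val_zero, Nat.add_zero, add_comm]
    congr 1
    exact sum_congr rfl fun k _ => by rw [val_step, show j + 1 + k = j + (k + 1) by omega]

end D8

namespace Cert

variable (c : Cert)

/-- Newton coefficients of the bottom functional (`S·C(j,m)` folded in; meaningful for `m ≤ 7`). -/
def eB : D8 :=
  ⟨c.Y0 + (if c.m = 0 then c.S else 0), c.Y1 + (if c.m = 1 then c.S else 0), c.Y2 + (if c.m = 2 then c.S else 0),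
    c.Y3 + (if c.m = 3 then c.S else 0), c.Y4 + (if c.m = 4 then c.S else 0), c.Y5 + (if c.m = 5 then c.S else 0),
    c.Y6 + (if c.m = 6 then c.S else 0), c.Y7 + (if c.m = 7 then c.S else 0)⟩

/-- Newton coefficients of the top functional. -/
def eT : D8 := ⟨c.z0, c.z1, c.z2, c.z3, c.z4, c.z5, c.zd6, c.zd7⟩

/-- FAST CHECK: `(m ≤ 7 ∧ both functionals ≥ 0 on their blocks, R)`. -/
def chk : Bool × ℤ :=
  let rb := D8.run (botU c.nb) c.eB 0 (c.nb + 1)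
  let rt := D8.run (topU c.nt c.g) c.eT 0 (c.nt + 1)
  (decide (c.m ≤ 7) && rb.1 && rt.1, rb.2 + rt.2 + c.Y7)

theorem eB_val (hm : c.m ≤ 7) (j : ℕ) : c.eB.val j = c.wb j := by
  simp only [D8.val, eB, wb, poly8]
  generalize c.m = m at *
  interval_cases m <;> simp <;> ring

theorem eT_val (j : ℕ) : c.eT.val j = c.wt j := rfl

theorem chk_spec (h : c.chk.1 = true) : c.OK ∧ c.chk.2 = c.R := by
  simp only [chk, Bool.and_eq_true, decide_eq_true_eq] at h
  obtain ⟨⟨hm, hb⟩, ht⟩ := h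
  have vb := D8.run_fst _ _ _ _ hb
  have vt := D8.run_fst _ _ _ _ ht
  refine ⟨⟨fun j hj => ?_, fun j hj => ?_⟩, ?_⟩
  · rw [← c.eB_val hm]; exact vb j hj
  · rw [← c.eT_val]; exact vt j hj
  · simp only [chk, R, B, D8.run_snd, Nat.zero_add]
    rw [sum_congr rfl fun j _ => by rw [c.eB_val hm]]
    rfl

end Cert

/-- one certificate: fast OK check, then a Boolean condition on its `R`. -/
def chkOne (c : Cert) (f : ℤ → Bool) : Bool :=
  let r := c.chk
  r.1 && f r.2

theorem chkOne_spec (c : Cert) (f : ℤ → Bool) (h : chkOne c f = true) : c.OK ∧ c.chk.2 = c.R ∧ f c.R = true := by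
  simp only [chkOne, Bool.and_eq_true] at h
  obtain ⟨ok, e⟩ := c.chk_spec h.1
  exact ⟨ok, e, e ▸ h.2⟩

/-- two certificates: fast OK checks, then a Boolean condition on their `R`s. -/
def chkPair (c₁ c₂ : Cert) (f : ℤ → ℤ → Bool) : Bool :=
  let r₁ := c₁.chk
  let r₂ := c₂.chk
  r₁.1 && r₂.1 && f r₁.2 r₂.2

theorem chkPair_spec (c₁ c₂ : Cert) (f : ℤ → ℤ → Bool) (h : chkPair c₁ c₂ f = true) :
    c₁.OK ∧ c₂.OK ∧ c₁.chk.2 = c₁.R ∧ c₂.chk.2 = c₂.R ∧ f c₁.R c₂.R = true := by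
  simp only [chkPair, Bool.and_eq_true] at h
  obtain ⟨⟨h1, h2⟩, hf⟩ := h
  obtain ⟨ok1, e1⟩ := c₁.chk_spec h1
  obtain ⟨ok2, e2⟩ := c₂.chk_spec h2
  exact ⟨ok1, ok2, e1, e2, by rw [← e1, ← e2]; exact hf⟩

theorem ite_mul_eq_of_zero (P : Prop) [Decidable P] (a b x : ℤ) (h : P → x = 0) :
    (if P then a else b) * x = b * x := by
  split_ifs with hp
  · rw [h hp, mul_zero, mul_zero]
  · rfl

/-- STAGE LAW (LP weak duality).  In a full-exchange pair whose local rows below the stage `m ≤ 6` vanish, a valid stage-`m`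
certificate bounds `S·β_m ≤ R`. -/
theorem stage_law (c : Cert) (hOK : c.OK) {Gb Gt : ℕ → ℤ} (hP : IsPairFull c.nb c.nt c.g Gb Gt)
    (hz : LowZero c.nb c.nt c.m Gb Gt) : c.S * brow Gb c.nb c.m ≤ c.R := by
  obtain ⟨r0, r1, r2, r3, r4, r5, r6, r7⟩ := rows_expand hP
  obtain ⟨hUb, hUt, -⟩ := hP
  have cb := capped_sum c.nb Gb (botU c.nb) c.wb hUb hOK.1
  have ct := capped_sum c.nt Gt (topU c.nt c.g) c.wt hUt hOK.2
  have eb : ∑ j ∈ range (c.nb + 1), Gb j * c.wb j =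
      (c.Y0 * brow Gb c.nb 0 + c.Y1 * brow Gb c.nb 1 + c.Y2 * brow Gb c.nb 2 + c.Y3 * brow Gb c.nb 3 + c.Y4 * brow Gb c.nb 4 +
        c.Y5 * brow Gb c.nb 5 + c.Y6 * brow Gb c.nb 6 + c.Y7 * brow Gb c.nb 7) + c.S * brow Gb c.nb c.m := by
    rw [← pairing8, brow, mul_sum, ← sum_add_distrib]
    exact sum_congr rfl fun j _ => by rw [Cert.wb]; ring
  have et : ∑ j ∈ range (c.nt + 1), Gt j * c.wt j =
      c.z0 * brow Gt c.nt 0 + c.z1 * brow Gt c.nt 1 + c.z2 * brow Gt c.nt 2 + c.z3 * brow Gt c.nt 3 + c.z4 * brow Gt c.nt 4 +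
        c.z5 * brow Gt c.nt 5 + c.zd6 * brow Gt c.nt 6 + c.zd7 * brow Gt c.nt 7 := by
    exact pairing8 Gt c.nt c.z0 c.z1 c.z2 c.z3 c.z4 c.z5 c.zd6 c.zd7
  have hρ : ∀ l, l < c.m → brow Gt c.nt l = 0 := fun l hl => (hz l hl).2
  have e0 : c.z0 * brow Gt c.nt 0 = c.zd0 * brow Gt c.nt 0 := ite_mul_eq_of_zero _ _ _ _ (hρ 0)
  have e1 : c.z1 * brow Gt c.nt 1 = c.zd1 * brow Gt c.nt 1 := ite_mul_eq_of_zero _ _ _ _ (hρ 1)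
  have e2 : c.z2 * brow Gt c.nt 2 = c.zd2 * brow Gt c.nt 2 := ite_mul_eq_of_zero _ _ _ _ (hρ 2)
  have e3 : c.z3 * brow Gt c.nt 3 = c.zd3 * brow Gt c.nt 3 := ite_mul_eq_of_zero _ _ _ _ (hρ 3)
  have e4 : c.z4 * brow Gt c.nt 4 = c.zd4 * brow Gt c.nt 4 := ite_mul_eq_of_zero _ _ _ _ (hρ 4)
  have e5 : c.z5 * brow Gt c.nt 5 = c.zd5 * brow Gt c.nt 5 := ite_mul_eq_of_zero _ _ _ _ (hρ 5)
  rw [e0, e1, e2, e3, e4, e5] at et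
  rw [eb] at cb; rw [et] at ct
  have key : (c.Y0 * brow Gb c.nb 0 + c.Y1 * brow Gb c.nb 1 + c.Y2 * brow Gb c.nb 2 + c.Y3 * brow Gb c.nb 3 +
      c.Y4 * brow Gb c.nb 4 + c.Y5 * brow Gb c.nb 5 + c.Y6 * brow Gb c.nb 6 + c.Y7 * brow Gb c.nb 7) +
      (c.zd0 * brow Gt c.nt 0 + c.zd1 * brow Gt c.nt 1 + c.zd2 * brow Gt c.nt 2 + c.zd3 * brow Gt c.nt 3 + c.zd4 * brow Gt c.nt 4 +
        c.zd5 * brow Gt c.nt 5 + c.zd6 * brow Gt c.nt 6 + c.zd7 * brow Gt c.nt 7) = -c.Y7 := by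
    simp only [Cert.zd0, Cert.zd1, Cert.zd2, Cert.zd3, Cert.zd4, Cert.zd5, Cert.zd6, Cert.zd7, Cert.tb, binomZ_zero]
    linear_combination c.Y0 * r0 + c.Y1 * r1 + c.Y2 * r2 + c.Y3 * r3 + c.Y4 * r4 + c.Y5 * r5 + c.Y6 * r6 + c.Y7 * r7
  simp only [Cert.R, Cert.B]
  linarith

/-- UPPER WINDOW: `S > 0` and `R < S` force `β_m ≤ 0`. -/
theorem le_zero_of_cert (c : Cert) (hOK : c.OK) (hS : 0 < c.S) (hR : c.R < c.S) {Gb Gt : ℕ → ℤ}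
    (hP : IsPairFull c.nb c.nt c.g Gb Gt) (hz : LowZero c.nb c.nt c.m Gb Gt) : brow Gb c.nb c.m ≤ 0 := by
  have h := stage_law c hOK hP hz
  nlinarith

/-- LOWER WINDOW: `S < 0` and `R < −S` force `0 ≤ β_m`. -/
theorem ge_zero_of_cert (c : Cert) (hOK : c.OK) (hS : c.S < 0) (hR : c.R < -c.S) {Gb Gt : ℕ → ℤ}
    (hP : IsPairFull c.nb c.nt c.g Gb Gt) (hz : LowZero c.nb c.nt c.m Gb Gt) : 0 ≤ brow Gb c.nb c.m := by
  have h := stage_law c hOK hP hz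
  nlinarith

/-- INTEGER UPPER BOUND: `S > 0` gives `β_m ≤ ⌊R / S⌋`. -/
theorem le_div_of_cert (c : Cert) (hOK : c.OK) (hS : 0 < c.S) {Gb Gt : ℕ → ℤ}
    (hP : IsPairFull c.nb c.nt c.g Gb Gt) (hz : LowZero c.nb c.nt c.m Gb Gt) : brow Gb c.nb c.m ≤ c.R / c.S := by
  have h := stage_law c hOK hP hz
  rw [Int.le_ediv_iff_mul_le hS]; linarith

/-- INTEGER LOWER BOUND: `S < 0` gives `−⌊R / (−S)⌋ ≤ β_m`. -/
theorem div_le_of_cert (c : Cert) (hOK : c.OK) (hS : c.S < 0) {Gb Gt : ℕ → ℤ}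
    (hP : IsPairFull c.nb c.nt c.g Gb Gt) (hz : LowZero c.nb c.nt c.m Gb Gt) : -(c.R / (-c.S)) ≤ brow Gb c.nb c.m := by
  have h := stage_law c hOK hP hz
  have hS' : 0 < -c.S := by omega
  have h2 : -brow Gb c.nb c.m ≤ c.R / (-c.S) := by rw [Int.le_ediv_iff_mul_le hS']; linarith
  omega

/-- FARKAS: `S = 0` and `R < 0` kill the stage. -/
theorem false_of_cert (c : Cert) (hOK : c.OK) (hS : c.S = 0) (hR : c.R < 0) {Gb Gt : ℕ → ℤ}
    (hP : IsPairFull c.nb c.nt c.g Gb Gt) (hz : LowZero c.nb c.nt c.m Gb Gt) : False := by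
  have h := stage_law c hOK hP hz
  rw [hS, zero_mul] at h
  exact absurd hR (not_lt.2 h)

/-! ## §4 Chains of certificates and verdicts (the generated tables instantiate these) -/

/-! ## §3c the ROW-5 BRANCH: stage-6 certificates under `β₅ = k ≠ 0`
With the five low rows vanishing and `β₅ = k` (hence `ρ₅ = −k`), the same certificate bounds `S·β₆ ≤ R + k·(Z₅ − zd₅)`. -/

theorem top5_of_bot5 {nb nt g : ℕ} {Gb Gt : ℕ → ℤ} (h : IsPairFull nb nt g Gb Gt) (hz : LowZero nb nt 5 Gb Gt) (k : ℤ)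
    (h5 : brow Gb nb 5 = k) : brow Gt nt 5 = -k := by
  obtain ⟨-, -, -, -, -, r5, -⟩ := rows_expand h
  rw [(hz 0 (by norm_num)).2, (hz 1 (by norm_num)).2, (hz 2 (by norm_num)).2, (hz 3 (by norm_num)).2,
    (hz 4 (by norm_num)).2, h5] at r5
  linarith

/-- the corrected bound of a stage-6 certificate on the branch `β₅ = k`. -/
def Cert.Rk (c : Cert) (k : ℤ) : ℤ := c.R + k * (c.Z5 - c.zd5)

theorem stage_law6k (c : Cert) (hOK : c.OK) (hm : c.m = 6) (k : ℤ) {Gb Gt : ℕ → ℤ} (hP : IsPairFull c.nb c.nt c.g Gb Gt)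
    (hz : LowZero c.nb c.nt 5 Gb Gt) (h5 : brow Gb c.nb 5 = k) : c.S * brow Gb c.nb 6 ≤ c.Rk k := by
  have hρ5 := top5_of_bot5 hP hz k h5
  obtain ⟨r0, r1, r2, r3, r4, r5, r6, r7⟩ := rows_expand hP
  obtain ⟨hUb, hUt, -⟩ := hP
  have cb := capped_sum c.nb Gb (botU c.nb) c.wb hUb hOK.1
  have ct := capped_sum c.nt Gt (topU c.nt c.g) c.wt hUt hOK.2
  have eb : ∑ j ∈ range (c.nb + 1), Gb j * c.wb j =
      (c.Y0 * brow Gb c.nb 0 + c.Y1 * brow Gb c.nb 1 + c.Y2 * brow Gb c.nb 2 + c.Y3 * brow Gb c.nb 3 + c.Y4 * brow Gb c.nb 4 +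
        c.Y5 * brow Gb c.nb 5 + c.Y6 * brow Gb c.nb 6 + c.Y7 * brow Gb c.nb 7) + c.S * brow Gb c.nb c.m := by
    rw [← pairing8, brow, mul_sum, ← sum_add_distrib]
    exact sum_congr rfl fun j _ => by rw [Cert.wb]; ring
  have et : ∑ j ∈ range (c.nt + 1), Gt j * c.wt j =
      c.z0 * brow Gt c.nt 0 + c.z1 * brow Gt c.nt 1 + c.z2 * brow Gt c.nt 2 + c.z3 * brow Gt c.nt 3 + c.z4 * brow Gt c.nt 4 +
        c.z5 * brow Gt c.nt 5 + c.zd6 * brow Gt c.nt 6 + c.zd7 * brow Gt c.nt 7 := by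
    exact pairing8 Gt c.nt c.z0 c.z1 c.z2 c.z3 c.z4 c.z5 c.zd6 c.zd7
  have q0 : brow Gt c.nt 0 = 0 := (hz 0 (by norm_num)).2
  have q1 : brow Gt c.nt 1 = 0 := (hz 1 (by norm_num)).2
  have q2 : brow Gt c.nt 2 = 0 := (hz 2 (by norm_num)).2
  have q3 : brow Gt c.nt 3 = 0 := (hz 3 (by norm_num)).2
  have q4 : brow Gt c.nt 4 = 0 := (hz 4 (by norm_num)).2
  have b0 : brow Gb c.nb 0 = 0 := (hz 0 (by norm_num)).1
  have b1 : brow Gb c.nb 1 = 0 := (hz 1 (by norm_num)).1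
  have b2 : brow Gb c.nb 2 = 0 := (hz 2 (by norm_num)).1
  have b3 : brow Gb c.nb 3 = 0 := (hz 3 (by norm_num)).1
  have b4 : brow Gb c.nb 4 = 0 := (hz 4 (by norm_num)).1
  have hz5 : c.z5 = c.Z5 := by simp [Cert.z5, hm]
  rw [q0, q1, q2, q3, q4, hρ5, hz5] at et
  rw [b0, b1, b2, b3, b4, h5, hm] at eb
  rw [q0, q1, q2, q3, q4, hρ5] at r6 r7
  rw [eb] at cb; rw [et] at ct
  have t6 : c.zd6 = c.Y6 * c.tb 0 + c.Y7 * c.tb 1 := rfl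
  have t7 : c.zd7 = c.Y7 * c.tb 0 := rfl
  have t5 : c.zd5 = c.Y5 * c.tb 0 + c.Y6 * c.tb 1 + c.Y7 * c.tb 2 := rfl
  simp only [Cert.tb, binomZ_zero, mul_one] at t5 t6 t7
  have key : c.Y5 * k + c.Y6 * brow Gb c.nb 6 + c.Y7 * brow Gb c.nb 7 + c.zd6 * brow Gt c.nt 6 + c.zd7 * brow Gt c.nt 7 =
      -c.Y7 + k * c.zd5 := by
    linear_combination (brow Gt c.nt 6) * t6 + (brow Gt c.nt 7) * t7 - k * t5 + c.Y6 * r6 + c.Y7 * r7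
  simp only [Cert.Rk, Cert.R, Cert.B]
  linarith [cb, ct, key]

theorem le_div_of_cert6k (c : Cert) (hOK : c.OK) (hm : c.m = 6) (hS : 0 < c.S) (k : ℤ) {Gb Gt : ℕ → ℤ}
    (hP : IsPairFull c.nb c.nt c.g Gb Gt) (hz : LowZero c.nb c.nt 5 Gb Gt) (h5 : brow Gb c.nb 5 = k) :
    brow Gb c.nb 6 ≤ c.Rk k / c.S := by
  have h := stage_law6k c hOK hm k hP hz h5
  rw [Int.le_ediv_iff_mul_le hS]; linarith

theorem div_le_of_cert6k (c : Cert) (hOK : c.OK) (hm : c.m = 6) (hS : c.S < 0) (k : ℤ) {Gb Gt : ℕ → ℤ}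
    (hP : IsPairFull c.nb c.nt c.g Gb Gt) (hz : LowZero c.nb c.nt 5 Gb Gt) (h5 : brow Gb c.nb 5 = k) :
    -(c.Rk k / (-c.S)) ≤ brow Gb c.nb 6 := by
  have h := stage_law6k c hOK hm k hP hz h5
  have hS' : 0 < -c.S := by omega
  have h2 : -brow Gb c.nb 6 ≤ c.Rk k / (-c.S) := by rw [Int.le_ediv_iff_mul_le hS']; linarith
  omega

theorem false_of_cert6k (c : Cert) (hOK : c.OK) (hm : c.m = 6) (hS : c.S = 0) (k : ℤ) (hR : c.Rk k < 0) {Gb Gt : ℕ → ℤ}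
    (hP : IsPairFull c.nb c.nt c.g Gb Gt) (hz : LowZero c.nb c.nt 5 Gb Gt) (h5 : brow Gb c.nb 5 = k) : False := by
  have h := stage_law6k c hOK hm k hP hz h5
  rw [hS, zero_mul] at h
  exact absurd hR (not_lt.mpr h)

/-- header check: the certificate is about the cell `(nb, nt, g)` at stage `m`. -/
abbrev Cert.Hdr (c : Cert) (nb nt g m : ℕ) : Prop := c.nb = nb ∧ c.nt = nt ∧ c.g = g ∧ c.m = m

/-- a ZERO PAIR at stage `m`: a lower and an upper window certificate whose windows exclude every nonzero integer. -/
abbrev ZeroPair (nb nt g m : ℕ) (p : Cert × Cert) : Prop :=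
  p.1.Hdr nb nt g m ∧ p.2.Hdr nb nt g m ∧ p.1.OK ∧ p.2.OK ∧ p.1.S < 0 ∧ p.1.R < -p.1.S ∧ 0 < p.2.S ∧ p.2.R < p.2.S

theorem zero_of_pair {nb nt g m : ℕ} (p : Cert × Cert) (h : ZeroPair nb nt g m p) {Gb Gt : ℕ → ℤ}
    (hP : IsPairFull nb nt g Gb Gt) (hz : LowZero nb nt m Gb Gt) : brow Gb nb m = 0 := by
  obtain ⟨⟨rfl, rfl, rfl, rfl⟩, ⟨h2a, h2b, h2c, h2d⟩, ok1, ok2, s1, r1, s2, r2⟩ := h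
  have lo := ge_zero_of_cert p.1 ok1 s1 r1 hP hz
  have hP2 : IsPairFull p.2.nb p.2.nt p.2.g Gb Gt := by rw [h2a, h2b, h2c]; exact hP
  have hz2 : LowZero p.2.nb p.2.nt p.2.m Gb Gt := by rw [h2a, h2b, h2d]; exact hz
  have hi := le_zero_of_cert p.2 ok2 s2 r2 hP2 hz2
  rw [h2a, h2d] at hi
  exact le_antisymm hi lo

/-- fast Boolean check of a zero pair. -/
def zpB (nb nt g m : ℕ) (p : Cert × Cert) : Bool :=
  decide (p.1.Hdr nb nt g m) && decide (p.2.Hdr nb nt g m) &&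
    chkPair p.1 p.2 fun R₁ R₂ => decide (p.1.S < 0) && decide (R₁ < -p.1.S) && decide (0 < p.2.S) && decide (R₂ < p.2.S)

theorem zeroPair_of_zpB {nb nt g m : ℕ} {p : Cert × Cert} (h : zpB nb nt g m p = true) : ZeroPair nb nt g m p := by
  simp only [zpB, Bool.and_eq_true, decide_eq_true_eq] at h
  obtain ⟨⟨h1, h2⟩, h3⟩ := h
  obtain ⟨ok1, ok2, -, -, hf⟩ := chkPair_spec _ _ _ h3
  simp only [Bool.and_eq_true, decide_eq_true_eq] at hf
  exact ⟨h1, h2, ok1, ok2, hf.1.1.1, hf.1.1.2, hf.1.2, hf.2⟩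

/-- the zero pairs, in order, force the rows `m, m+1, …` (Boolean, kernel-decidable). -/
def chainOK (nb nt g : ℕ) : ℕ → List (Cert × Cert) → Bool
  | _, [] => true
  | m, p :: ps => zpB nb nt g m p && chainOK nb nt g (m + 1) ps

theorem lowZero_of_chain (nb nt g : ℕ) :
    ∀ (ps : List (Cert × Cert)) (m : ℕ), chainOK nb nt g m ps = true → m + ps.length ≤ 7 →
      ∀ {Gb Gt : ℕ → ℤ}, IsPairFull nb nt g Gb Gt → LowZero nb nt m Gb Gt → LowZero nb nt (m + ps.length) Gb Gt
  | [], m, _, _, _, _, _, hz => by simpa using hz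
  | p :: ps, m, h, hlen, Gb, Gt, hP, hz => by
    simp only [chainOK, Bool.and_eq_true] at h
    simp only [List.length_cons] at hlen ⊢
    have hb := zero_of_pair p (zeroPair_of_zpB h.1) hP hz
    have hz' := lowZero_succ hP hz (by omega) hb
    have ih := lowZero_of_chain nb nt g ps (m + 1) h.2 (by omega) hP hz'
    simpa [Nat.add_assoc, Nat.add_comm 1] using ih

/-- the verdict of a cell: REDUCED (`red`: six zero pairs, then the two window certificates of `β₆`), DEAD after `k` zero pairs by a
Farkas certificate (`deadF`) or by an integer-empty window (`deadW`: lower certificate `cl`, upper certificate `cu`), or OPEN at stage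
`k` (`opn`: `k` zero pairs, then window certificates of `β_k` whose integer window holds a nonzero integer — the cascade stops there). -/
inductive Sub
  | leaf (cl cu : Cert)
  | deadF (f : Cert)
  | deadW (cl cu : Cert)

/-- `Sub` = the verdict of ONE BRANCH `β₅ = k` of an open cell at stage 6: a certified `β₆` window (`leaf`), a Farkas kill
(`deadF`) or an integer-empty `β₆` window (`deadW`).  An open verdict lists one branch verdict for EVERY integer of the `β₅` window. -/
inductive Verdict
  | red (ps : List (Cert × Cert)) (cl cu : Cert)
  | deadF (ps : List (Cert × Cert)) (f : Cert)
  | deadW (ps : List (Cert × Cert)) (cl cu : Cert)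
  | opn (ps : List (Cert × Cert)) (cl cu : Cert) (subs : List (ℤ × Sub))

/-- the trivial certificate / default verdict (used only as `List.getD` padding). -/
def Cert.triv : Cert := ⟨0, 0, 0, 0, 0, 0, 0, 0, 0, 0, 0, 0, 0, 0, 0, 0, 0, 0, 0⟩

def Verdict.dflt : Verdict := .deadF [] Cert.triv

/-- a WINDOW PAIR at stage `m`: a lower (`S < 0`) and an upper (`S > 0`) certificate. -/
abbrev WinPair (nb nt g m : ℕ) (cl cu : Cert) : Prop :=
  cl.Hdr nb nt g m ∧ cu.Hdr nb nt g m ∧ cl.OK ∧ cu.OK ∧ cl.S < 0 ∧ 0 < cu.S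

def wpB (nb nt g m : ℕ) (cl cu : Cert) : Bool :=
  decide (cl.Hdr nb nt g m) && decide (cu.Hdr nb nt g m) && chkPair cl cu fun _ _ => decide (cl.S < 0) && decide (0 < cu.S)

theorem winPair_of_wpB {nb nt g m : ℕ} {cl cu : Cert} (h : wpB nb nt g m cl cu = true) :
    WinPair nb nt g m cl cu ∧ cl.chk.2 = cl.R ∧ cu.chk.2 = cu.R := by
  simp only [wpB, Bool.and_eq_true, decide_eq_true_eq] at h
  obtain ⟨⟨h1, h2⟩, h3⟩ := h
  obtain ⟨ok1, ok2, e1, e2, hf⟩ := chkPair_spec _ _ _ h3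
  simp only [Bool.and_eq_true, decide_eq_true_eq] at hf
  exact ⟨⟨h1, h2, ok1, ok2, hf.1, hf.2⟩, e1, e2⟩

/-- Farkas kill at stage `m`. -/
def dfB (nb nt g m : ℕ) (f : Cert) : Bool :=
  decide (f.Hdr nb nt g m) && chkOne f fun R => decide (f.S = 0) && decide (R < 0)

theorem dfB_spec {nb nt g m : ℕ} {f : Cert} (h : dfB nb nt g m f = true) : f.Hdr nb nt g m ∧ f.OK ∧ f.S = 0 ∧ f.R < 0 := by
  simp only [dfB, Bool.and_eq_true, decide_eq_true_eq] at h
  obtain ⟨h1, h2⟩ := h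
  obtain ⟨ok, -, hf⟩ := chkOne_spec _ _ h2
  simp only [Bool.and_eq_true, decide_eq_true_eq] at hf
  exact ⟨h1, ok, hf.1, hf.2⟩

/-- empty-window kill at stage `m`: `⌊R_u/S_u⌋ < ⌈−R_l/(−S_l)⌉`, as `R_l < S_l·⌊R_u/S_u⌋`. -/
def dwB (nb nt g m : ℕ) (cl cu : Cert) : Bool :=
  decide (cl.Hdr nb nt g m) && decide (cu.Hdr nb nt g m) &&
    chkPair cl cu fun Rl Ru => decide (cl.S < 0) && decide (0 < cu.S) && decide (Rl < cl.S * (Ru / cu.S))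

theorem dwB_spec {nb nt g m : ℕ} {cl cu : Cert} (h : dwB nb nt g m cl cu = true) :
    cl.Hdr nb nt g m ∧ cu.Hdr nb nt g m ∧ cl.OK ∧ cu.OK ∧ cl.S < 0 ∧ 0 < cu.S ∧ cl.R < cl.S * (cu.R / cu.S) := by
  simp only [dwB, Bool.and_eq_true, decide_eq_true_eq] at h
  obtain ⟨⟨h1, h2⟩, h3⟩ := h
  obtain ⟨ok1, ok2, -, -, hf⟩ := chkPair_spec _ _ _ h3
  simp only [Bool.and_eq_true, decide_eq_true_eq] at hf
  exact ⟨h1, h2, ok1, ok2, hf.1.1, hf.1.2, hf.2⟩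

/-- Boolean check of a branch verdict (`β₅ = k`, stage 6). -/
def Sub.ok (nb nt g : ℕ) (k : ℤ) : Sub → Bool
  | .leaf cl cu => wpB nb nt g 6 cl cu
  | .deadF f => decide (f.Hdr nb nt g 6) && chkOne f fun R => decide (f.S = 0) && decide (R + k * (f.Z5 - f.zd5) < 0)
  | .deadW cl cu => decide (cl.Hdr nb nt g 6) && decide (cu.Hdr nb nt g 6) &&
      chkPair cl cu fun Rl Ru => decide (cl.S < 0) && decide (0 < cu.S) &&
        decide (Rl + k * (cl.Z5 - cl.zd5) < cl.S * ((Ru + k * (cu.Z5 - cu.zd5)) / cu.S))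

def Sub.isLeaf : Sub → Bool
  | .leaf _ _ => true
  | _ => false

/-- certified `β₆` window of a leaf branch. -/
def Sub.lo (k : ℤ) : Sub → ℤ
  | .leaf cl _ => -((cl.chk.2 + k * (cl.Z5 - cl.zd5)) / (-cl.S))
  | _ => 0

def Sub.hi (k : ℤ) : Sub → ℤ
  | .leaf _ cu => (cu.chk.2 + k * (cu.Z5 - cu.zd5)) / cu.S
  | _ => 0

/-- what a checked branch verdict proves about `β₆` on its branch (a dead branch proves `False`). -/
def Sub.Claim (k : ℤ) (s : Sub) (b6 : ℤ) : Prop := s.isLeaf = true ∧ s.lo k ≤ b6 ∧ b6 ≤ s.hi k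

theorem sub_sound {nb nt g : ℕ} (k : ℤ) (s : Sub) (h : s.ok nb nt g k = true) {Gb Gt : ℕ → ℤ}
    (hP : IsPairFull nb nt g Gb Gt) (hz : LowZero nb nt 5 Gb Gt) (h5 : brow Gb nb 5 = k) : s.Claim k (brow Gb nb 6) := by
  cases s with
  | leaf cl cu =>
    obtain ⟨⟨⟨hla, hlb, hlc, hld⟩, ⟨hua, hub, huc, hud⟩, okl, oku, sl, su⟩, el, eu⟩ := winPair_of_wpB h
    have hPu : IsPairFull cu.nb cu.nt cu.g Gb Gt := by rw [hua, hub, huc]; exact hP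
    have hzu : LowZero cu.nb cu.nt 5 Gb Gt := by rw [hua, hub]; exact hz
    have h5u : brow Gb cu.nb 5 = k := by rw [hua]; exact h5
    have hi := le_div_of_cert6k cu oku hud su k hPu hzu h5u
    have hPl : IsPairFull cl.nb cl.nt cl.g Gb Gt := by rw [hla, hlb, hlc]; exact hP
    have hzl : LowZero cl.nb cl.nt 5 Gb Gt := by rw [hla, hlb]; exact hz
    have h5l : brow Gb cl.nb 5 = k := by rw [hla]; exact h5
    have lo := div_le_of_cert6k cl okl hld sl k hPl hzl h5l
    rw [hua] at hi
    rw [hla] at lo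
    refine ⟨rfl, ?_, ?_⟩
    · simp only [Sub.lo, el]; exact lo
    · simp only [Sub.hi, eu]; exact hi
  | deadF f =>
    simp only [Sub.ok, Bool.and_eq_true, decide_eq_true_eq] at h
    obtain ⟨⟨hfa, hfb, hfc, hfd⟩, h2⟩ := h
    obtain ⟨ok, -, hf⟩ := chkOne_spec _ _ h2
    simp only [Bool.and_eq_true, decide_eq_true_eq] at hf
    have hPf : IsPairFull f.nb f.nt f.g Gb Gt := by rw [hfa, hfb, hfc]; exact hP
    have hzf : LowZero f.nb f.nt 5 Gb Gt := by rw [hfa, hfb]; exact hz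
    have h5f : brow Gb f.nb 5 = k := by rw [hfa]; exact h5
    exact (false_of_cert6k f ok hfd hf.1 k hf.2 hPf hzf h5f).elim
  | deadW cl cu =>
    simp only [Sub.ok, Bool.and_eq_true, decide_eq_true_eq] at h
    obtain ⟨⟨⟨hla, hlb, hlc, hld⟩, ⟨hua, hub, huc, hud⟩⟩, h3⟩ := h
    obtain ⟨okl, oku, -, -, hf⟩ := chkPair_spec _ _ _ h3
    simp only [Bool.and_eq_true, decide_eq_true_eq] at hf
    obtain ⟨⟨sl, su⟩, hlt⟩ := hf
    have hPu : IsPairFull cu.nb cu.nt cu.g Gb Gt := by rw [hua, hub, huc]; exact hP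
    have hzu : LowZero cu.nb cu.nt 5 Gb Gt := by rw [hua, hub]; exact hz
    have h5u : brow Gb cu.nb 5 = k := by rw [hua]; exact h5
    have hi := le_div_of_cert6k cu oku hud su k hPu hzu h5u
    have hPl : IsPairFull cl.nb cl.nt cl.g Gb Gt := by rw [hla, hlb, hlc]; exact hP
    have hzl : LowZero cl.nb cl.nt 5 Gb Gt := by rw [hla, hlb]; exact hz
    have h5l : brow Gb cl.nb 5 = k := by rw [hla]; exact h5
    have lo := stage_law6k cl okl hld k hPl hzl h5l
    rw [hua] at hi
    rw [hla] at lo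
    have hmul := mul_le_mul_of_nonpos_left hi (le_of_lt sl)
    simp only [Cert.Rk] at lo hmul
    exact absurd (lt_of_le_of_lt (le_trans hmul lo) hlt) (lt_irrefl _)

/-- the branch list covers every integer of `[lo, hi]`, in increasing order. -/
def covers : ℤ → ℤ → List (ℤ × Sub) → Bool
  | a, b, [] => decide (b < a)
  | a, b, (k, _) :: rest => decide (k = a) && covers (a + 1) b rest

theorem mem_of_covers : ∀ (subs : List (ℤ × Sub)) (a b : ℤ), covers a b subs = true →
    ∀ x : ℤ, a ≤ x → x ≤ b → ∃ s, (x, s) ∈ subs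
  | [], a, b, h, x, h1, h2 => by
    simp only [covers, decide_eq_true_eq] at h
    omega
  | (k, s) :: rest, a, b, h, x, h1, h2 => by
    simp only [covers, Bool.and_eq_true, decide_eq_true_eq] at h
    rcases eq_or_lt_of_le h1 with rfl | hlt
    · exact ⟨s, by rw [h.1]; exact List.mem_cons_self⟩
    · obtain ⟨s', hs'⟩ := mem_of_covers rest (a + 1) b h.2 x (by omega) h2
      exact ⟨s', List.mem_cons_of_mem _ hs'⟩

/-- all branch verdicts check. -/
def subsOK (nb nt g : ℕ) : List (ℤ × Sub) → Bool
  | [] => true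
  | (k, s) :: rest => s.ok nb nt g k && subsOK nb nt g rest

theorem subOK_of_mem {nb nt g : ℕ} : ∀ (subs : List (ℤ × Sub)), subsOK nb nt g subs = true →
    ∀ k s, (k, s) ∈ subs → s.ok nb nt g k = true
  | [], _, k, s, hm => by simp at hm
  | (k', s') :: rest, h, k, s, hm => by
    simp only [subsOK, Bool.and_eq_true] at h
    rcases List.mem_cons.1 hm with e | hm'
    · cases e; exact h.1
    · exact subOK_of_mem rest h.2 k s hm'

/-- the kernel-decidable check of a verdict for the cell `(nb, nt, g)`. -/
def Verdict.ok (nb nt g : ℕ) : Verdict → Bool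
  | .red ps cl cu => chainOK nb nt g 0 ps && decide (ps.length = 6) && wpB nb nt g 6 cl cu
  | .deadF ps f => chainOK nb nt g 0 ps && decide (ps.length ≤ 6) && dfB nb nt g ps.length f
  | .deadW ps cl cu => chainOK nb nt g 0 ps && decide (ps.length ≤ 6) && dwB nb nt g ps.length cl cu
  | .opn ps cl cu subs => chainOK nb nt g 0 ps && decide (ps.length = 5) && wpB nb nt g 5 cl cu &&
      covers (-(cl.chk.2 / (-cl.S))) (cu.chk.2 / cu.S) subs && subsOK nb nt g subs

/-- does the verdict claim the cell DEAD? -/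
def Verdict.isDead : Verdict → Bool
  | .red _ _ _ => false
  | .deadF _ _ => true
  | .deadW _ _ _ => true
  | .opn _ _ _ subs => subs.all fun ks => !ks.2.isLeaf

/-- is the cell genuinely OPEN (some branch `β₅ = k ≠ 0` is alive at stage 6)? -/
def Verdict.isOpn : Verdict → Bool
  | .opn _ _ _ subs => subs.any fun ks => ks.2.isLeaf && decide (ks.1 ≠ 0)
  | _ => false

/-- the stage whose window the verdict certifies (`6` for a reduced cell). -/
def Verdict.stage : Verdict → ℕ
  | .red _ _ _ => 6
  | .deadF ps _ => ps.length
  | .deadW ps _ _ => ps.length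
  | .opn ps _ _ _ => ps.length

/-- certified integer window `[lo, hi]` of `β_stage` (meaningful for `red` / `opn`). -/
def Verdict.lo : Verdict → ℤ
  | .red _ cl _ => -(cl.chk.2 / (-cl.S))
  | .opn _ cl _ _ => -(cl.chk.2 / (-cl.S))
  | _ => 0

def Verdict.hi : Verdict → ℤ
  | .red _ _ cu => cu.chk.2 / cu.S
  | .opn _ _ cu _ => cu.chk.2 / cu.S
  | _ => 0

theorem cellDeadFull_of_deadF {nb nt g : ℕ} (ps : List (Cert × Cert)) (f : Cert)
    (h : Verdict.ok nb nt g (.deadF ps f) = true) : CellDeadFull nb nt g := by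
  intro Gb Gt hP
  simp only [Verdict.ok, Bool.and_eq_true, decide_eq_true_eq] at h
  obtain ⟨⟨hc, hlen⟩, hf⟩ := h
  obtain ⟨⟨hfa, hfb, hfc, hfd⟩, ok, s0, r0⟩ := dfB_spec hf
  have hz := lowZero_of_chain nb nt g ps 0 hc (by omega) hP lowZero_zero
  rw [Nat.zero_add] at hz
  have hPf : IsPairFull f.nb f.nt f.g Gb Gt := by rw [hfa, hfb, hfc]; exact hP
  have hzf : LowZero f.nb f.nt f.m Gb Gt := by rw [hfa, hfb, hfd]; exact hz
  exact false_of_cert f ok s0 r0 hPf hzf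

theorem cellDeadFull_of_deadW {nb nt g : ℕ} (ps : List (Cert × Cert)) (cl cu : Cert)
    (h : Verdict.ok nb nt g (.deadW ps cl cu) = true) : CellDeadFull nb nt g := by
  intro Gb Gt hP
  simp only [Verdict.ok, Bool.and_eq_true, decide_eq_true_eq] at h
  obtain ⟨⟨hc, hlen⟩, hw⟩ := h
  obtain ⟨⟨hla, hlb, hlc, hld⟩, ⟨hua, hub, huc, hud⟩, okl, oku, sl, su, hlt⟩ := dwB_spec hw
  have hz := lowZero_of_chain nb nt g ps 0 hc (by omega) hP lowZero_zero
  rw [Nat.zero_add] at hz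
  have hPu : IsPairFull cu.nb cu.nt cu.g Gb Gt := by rw [hua, hub, huc]; exact hP
  have hzu : LowZero cu.nb cu.nt cu.m Gb Gt := by rw [hua, hub, hud]; exact hz
  have hi := le_div_of_cert cu oku su hPu hzu
  have hPl : IsPairFull cl.nb cl.nt cl.g Gb Gt := by rw [hla, hlb, hlc]; exact hP
  have hzl : LowZero cl.nb cl.nt cl.m Gb Gt := by rw [hla, hlb, hld]; exact hz
  have lo := stage_law cl okl hPl hzl
  rw [hua, hud] at hi
  rw [hla, hld] at lo
  have hmul := mul_le_mul_of_nonpos_left hi (le_of_lt sl)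
  linarith

theorem reduces_of_red {nb nt g : ℕ} (ps : List (Cert × Cert)) (cl cu : Cert)
    (h : Verdict.ok nb nt g (.red ps cl cu) = true) : Reduces nb nt g := by
  intro Gb Gt hP
  simp only [Verdict.ok, Bool.and_eq_true, decide_eq_true_eq] at h
  obtain ⟨⟨hc, hlen⟩, -⟩ := h
  have hz := lowZero_of_chain nb nt g ps 0 hc (by omega) hP lowZero_zero
  rw [Nat.zero_add, hlen] at hz
  exact isPair_of_lowZero6 hP hz

theorem window_of_winPair {nb nt g m : ℕ} (cl cu : Cert) (h : WinPair nb nt g m cl cu) {Gb Gt : ℕ → ℤ}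
    (hP : IsPairFull nb nt g Gb Gt) (hz : LowZero nb nt m Gb Gt) :
    -(cl.R / (-cl.S)) ≤ brow Gb nb m ∧ brow Gb nb m ≤ cu.R / cu.S := by
  obtain ⟨⟨hla, hlb, hlc, hld⟩, ⟨hua, hub, huc, hud⟩, okl, oku, sl, su⟩ := h
  have hPu : IsPairFull cu.nb cu.nt cu.g Gb Gt := by rw [hua, hub, huc]; exact hP
  have hzu : LowZero cu.nb cu.nt cu.m Gb Gt := by rw [hua, hub, hud]; exact hz
  have hi := le_div_of_cert cu oku su hPu hzu
  have hPl : IsPairFull cl.nb cl.nt cl.g Gb Gt := by rw [hla, hlb, hlc]; exact hP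
  have hzl : LowZero cl.nb cl.nt cl.m Gb Gt := by rw [hla, hlb, hld]; exact hz
  have lo := div_le_of_cert cl okl sl hPl hzl
  rw [hua, hud] at hi
  rw [hla, hld] at lo
  exact ⟨lo, hi⟩

/-- OPEN-CELL SOUNDNESS: the five low rows vanish, `β₅` lies in the certified window, and the branch verdict of `k = β₅`
holds: a leaf pins `β₆` to its window, a dead branch is impossible. -/
theorem opn_sound {nb nt g : ℕ} (ps : List (Cert × Cert)) (cl cu : Cert) (subs : List (ℤ × Sub))
    (h : Verdict.ok nb nt g (.opn ps cl cu subs) = true) :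
    ∀ Gb Gt : ℕ → ℤ, IsPairFull nb nt g Gb Gt →
      LowZero nb nt 5 Gb Gt ∧ ∃ ks ∈ subs, brow Gb nb 5 = ks.1 ∧ ks.2.Claim ks.1 (brow Gb nb 6) := by
  intro Gb Gt hP
  simp only [Verdict.ok, Bool.and_eq_true, decide_eq_true_eq] at h
  obtain ⟨⟨⟨⟨hc, hlen⟩, hw⟩, hcov⟩, hsubs⟩ := h
  have hz := lowZero_of_chain nb nt g ps 0 hc (by omega) hP lowZero_zero
  rw [Nat.zero_add, hlen] at hz
  obtain ⟨hw, el, eu⟩ := winPair_of_wpB hw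
  have w := window_of_winPair cl cu hw hP hz
  rw [← el, ← eu] at w
  obtain ⟨s, hs⟩ := mem_of_covers subs _ _ hcov (brow Gb nb 5) w.1 w.2
  exact ⟨hz, (brow Gb nb 5, s), hs, rfl, sub_sound _ s (subOK_of_mem subs hsubs _ s hs) hP hz rfl⟩

/-- WINDOW SOUNDNESS: a checked verdict certifies that the rows below its stage vanish and that `β_stage` lies in `[lo, hi]`
(vacuous for dead cells; for `red` the stage is 6 and `[lo, hi]` is the charge window, charge `c = ρ₆ = −β₆`). -/
theorem window_of_verdict {nb nt g : ℕ} (v : Verdict) (h : v.ok nb nt g = true) (k : ℕ) (lo hi : ℤ)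
    (hk : v.stage = k) (hlo : lo ≤ v.lo) (hhi : v.hi ≤ hi) :
    ∀ Gb Gt : ℕ → ℤ, IsPairFull nb nt g Gb Gt → LowZero nb nt k Gb Gt ∧ lo ≤ brow Gb nb k ∧ brow Gb nb k ≤ hi := by
  intro Gb Gt hP
  cases v with
  | deadF ps f => exact (cellDeadFull_of_deadF ps f h Gb Gt hP).elim
  | deadW ps cl cu => exact (cellDeadFull_of_deadW ps cl cu h Gb Gt hP).elim
  | red ps cl cu =>
    simp only [Verdict.ok, Bool.and_eq_true, decide_eq_true_eq] at h
    obtain ⟨⟨hc, hlen⟩, hw⟩ := h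
    have hz := lowZero_of_chain nb nt g ps 0 hc (by omega) hP lowZero_zero
    rw [Nat.zero_add, hlen] at hz
    simp only [Verdict.stage] at hk; subst hk
    obtain ⟨hw, el, eu⟩ := winPair_of_wpB hw
    have w := window_of_winPair cl cu hw hP hz
    simp only [Verdict.lo, Verdict.hi, el, eu] at hlo hhi
    exact ⟨hz, le_trans hlo w.1, le_trans w.2 hhi⟩
  | opn ps cl cu subs =>
    simp only [Verdict.ok, Bool.and_eq_true, decide_eq_true_eq] at h
    obtain ⟨⟨⟨⟨hc, hlen⟩, hw⟩, -⟩, -⟩ := h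
    have hz := lowZero_of_chain nb nt g ps 0 hc (by omega) hP lowZero_zero
    rw [Nat.zero_add] at hz
    simp only [Verdict.stage] at hk; subst hk
    obtain ⟨hw, el, eu⟩ := winPair_of_wpB hw
    rw [hlen] at hz
    have w := window_of_winPair cl cu hw hP hz
    simp only [Verdict.lo, Verdict.hi, el, eu, hlen] at hlo hhi ⊢
    exact ⟨hz, le_trans hlo w.1, le_trans w.2 hhi⟩

/-- VERDICT SOUNDNESS: a checked verdict that is not OPEN proves the reduction; a checked DEAD verdict proves the cell empty. -/
theorem reduces_of_verdict {nb nt g : ℕ} (v : Verdict) (h : v.ok nb nt g = true) (hno : v.isOpn = false) :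
    Reduces nb nt g := by
  cases v with
  | red ps cl cu => exact reduces_of_red ps cl cu h
  | deadF ps f => exact fun Gb Gt hP => (cellDeadFull_of_deadF ps f h Gb Gt hP).elim
  | deadW ps cl cu => exact fun Gb Gt hP => (cellDeadFull_of_deadW ps cl cu h Gb Gt hP).elim
  | opn ps cl cu subs =>
    intro Gb Gt hP
    obtain ⟨hz, ks, hmem, h5, hleaf, -⟩ := opn_sound ps cl cu subs h Gb Gt hP
    have hall := List.any_eq_false.1 hno ks hmem
    simp only [hleaf, Bool.true_and, decide_eq_true_eq, not_not] at hall
    rw [hall] at h5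
    exact isPair_of_lowZero6 hP (lowZero_succ hP hz (by norm_num) h5)

theorem dead_of_verdict {nb nt g : ℕ} (v : Verdict) (h : v.ok nb nt g = true) (hd : v.isDead = true) :
    CellDeadFull nb nt g := by
  cases v with
  | red ps cl cu => simp [Verdict.isDead] at hd
  | deadF ps f => exact cellDeadFull_of_deadF ps f h
  | deadW ps cl cu => exact cellDeadFull_of_deadW ps cl cu h
  | opn ps cl cu subs =>
    intro Gb Gt hP
    obtain ⟨-, ks, hmem, -, hleaf, -⟩ := opn_sound ps cl cu subs h Gb Gt hP
    have hall := List.all_eq_true.1 hd ks hmem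
    simp [hleaf] at hall

/-- ROWS 0–4 (indeed 0–4 and, off the open cells, 5) NEVER EXCHANGE: every checked verdict forces the five low rows. -/
theorem low5_of_verdict {nb nt g : ℕ} (v : Verdict) (h : v.ok nb nt g = true) :
    ∀ Gb Gt : ℕ → ℤ, IsPairFull nb nt g Gb Gt → LowZero nb nt 5 Gb Gt := by
  intro Gb Gt hP
  cases v with
  | red ps cl cu =>
    simp only [Verdict.ok, Bool.and_eq_true, decide_eq_true_eq] at h
    obtain ⟨⟨hc, hlen⟩, -⟩ := h
    have hz := lowZero_of_chain nb nt g ps 0 hc (by omega) hP lowZero_zero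
    rw [Nat.zero_add, hlen] at hz
    exact fun l hl => hz l (by omega)
  | deadF ps f => exact (cellDeadFull_of_deadF ps f h Gb Gt hP).elim
  | deadW ps cl cu => exact (cellDeadFull_of_deadW ps cl cu h Gb Gt hP).elim
  | opn ps cl cu subs => exact (opn_sound ps cl cu subs h Gb Gt hP).1

/-- readable form of a branch claim: `none` = the branch is dead, `some (lo, hi)` = `lo ≤ β₆ ≤ hi`. -/
def Sat : Option (ℤ × ℤ) → ℤ → Prop
  | none, _ => False
  | some w, b => w.1 ≤ b ∧ b ≤ w.2

/-- the literal branch table `tab` is implied by the checked branch verdicts `subs` (same keys, windows no tighter). -/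
def subsMatchL : List (ℤ × Sub) → List (ℤ × Option (ℤ × ℤ)) → Bool
  | [], [] => true
  | (k, s) :: r, (k', none) :: r' => decide (k = k') && !s.isLeaf && subsMatchL r r'
  | (k, s) :: r, (k', some w) :: r' => decide (k = k') && s.isLeaf && decide (w.1 ≤ s.lo k) && decide (s.hi k ≤ w.2) &&
      subsMatchL r r'
  | _, _ => false

theorem sat_of_subsMatch : ∀ (subs : List (ℤ × Sub)) (tab : List (ℤ × Option (ℤ × ℤ))), subsMatchL subs tab = true →
    ∀ (k : ℤ) (s : Sub) (b : ℤ), (k, s) ∈ subs → s.Claim k b → ∃ e ∈ tab, e.1 = k ∧ Sat e.2 b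
  | [], _, _, k, s, b, hm, _ => by simp at hm
  | (k₀, s₀) :: r, [], h, _, _, _, _, _ => by simp [subsMatchL] at h
  | (k₀, s₀) :: r, (k', none) :: r', h, k, s, b, hm, hc => by
    simp only [subsMatchL, Bool.and_eq_true, decide_eq_true_eq, Bool.not_eq_true'] at h
    obtain ⟨⟨hk, hl⟩, hr⟩ := h
    rcases List.mem_cons.1 hm with e | hm'
    · cases e
      exact absurd hc.1 (by simp [hl])
    · obtain ⟨e, he, h1, h2⟩ := sat_of_subsMatch r r' hr k s b hm' hc
      exact ⟨e, List.mem_cons_of_mem _ he, h1, h2⟩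
  | (k₀, s₀) :: r, (k', some w) :: r', h, k, s, b, hm, hc => by
    simp only [subsMatchL, Bool.and_eq_true, decide_eq_true_eq] at h
    obtain ⟨⟨⟨⟨hk, hl⟩, hlo⟩, hhi⟩, hr⟩ := h
    rcases List.mem_cons.1 hm with e | hm'
    · cases e
      exact ⟨(k', some w), List.mem_cons_self, hk.symm, le_trans hlo hc.2.1, le_trans hc.2.2 hhi⟩
    · obtain ⟨e, he, h1, h2⟩ := sat_of_subsMatch r r' hr k s b hm' hc
      exact ⟨e, List.mem_cons_of_mem _ he, h1, h2⟩

def Verdict.subsMatch : Verdict → List (ℤ × Option (ℤ × ℤ)) → Bool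
  | .opn _ _ _ subs, tab => subsMatchL subs tab
  | _, _ => false

/-- OPEN-CELL TABLE: a checked open verdict whose branch table matches the literal table `tab` proves: the five low rows vanish
and `(β₅, β₆)` satisfies one line of `tab` (a `none` line is a dead branch). -/
theorem open_table_sound {nb nt g : ℕ} (v : Verdict) (h : v.ok nb nt g = true) (tab : List (ℤ × Option (ℤ × ℤ)))
    (hm : v.subsMatch tab = true) : ∀ Gb Gt : ℕ → ℤ, IsPairFull nb nt g Gb Gt →
      LowZero nb nt 5 Gb Gt ∧ ∃ e ∈ tab, brow Gb nb 5 = e.1 ∧ Sat e.2 (brow Gb nb 6) := by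
  intro Gb Gt hP
  cases v with
  | red _ _ _ => simp [Verdict.subsMatch] at hm
  | deadF _ _ => simp [Verdict.subsMatch] at hm
  | deadW _ _ _ => simp [Verdict.subsMatch] at hm
  | opn ps cl cu subs =>
    obtain ⟨hz, ks, hmem, h5, hc⟩ := opn_sound ps cl cu subs h Gb Gt hP
    obtain ⟨e, he, h1, h2⟩ := sat_of_subsMatch subs tab hm ks.1 ks.2 _ hmem hc
    exact ⟨hz, e, he, h5.trans h1.symm, h2⟩

/-- a dead cell of the full family is dead in the row-6 family too. -/
theorem cellDead_of_cellDeadFull {nb nt g : ℕ} (h : CellDeadFull nb nt g) : CellDead nb nt g :=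
  fun Gb Gt hp => h Gb Gt (isPairFull_of_isPair hp)

/-- FAMILY TABLES: a list of verdicts indexed by the top degree `nt = 0, 1, …`. -/
theorem reduces_of_table (nb g : ℕ) (tbl : List Verdict)
    (h : ∀ nt < tbl.length, (tbl.getD nt Verdict.dflt).ok nb nt g = true) :
    ∀ nt < tbl.length, (tbl.getD nt Verdict.dflt).isOpn = false → Reduces nb nt g :=
  fun nt hnt hno => reduces_of_verdict _ (h nt hnt) hno

theorem dead_of_table (nb g : ℕ) (tbl : List Verdict)
    (h : ∀ nt < tbl.length, (tbl.getD nt Verdict.dflt).ok nb nt g = true) :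
    ∀ nt < tbl.length, (tbl.getD nt Verdict.dflt).isDead = true → CellDeadFull nb nt g :=
  fun nt hnt hd => dead_of_verdict _ (h nt hnt) hd

end Summit.HodgeConjecture.HodgeConjecture.Cruxes.BlochSeedDiscOne.SeedChecker.FullExchange
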